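import Mathlib.Combinatorics.SimpleGraph.Walk.Operations
import Mathlib.Topology.Connected.Basic
import HarnessLib

/-!
# Crux `NoZenoR` (stmt-ResolutionOfSingularities-19943), slot `stub_L1wCoreF`, (B1) split core, assembly seam (A3):
# a connected finite union of non-empty closed sets is walk-connected in any graph joining the sets that meet

Route `ResolutionOfSingularities/HomologicalConductor`.  OURS (cell res-hironaka, crux chain W4.4, lead seat
res-L0-w44-lead-1 g8, memo `B1-CENSUS-g8.md` §2 (A3)); nothing here is a statement of the manuscript under review
(Hironaka 2017); AI-written, weaker than expert review.

STEP 3 (3) of the (B1) split core feeds G-comb (`…NoZenoTreeSeparation`: `IsAcyclic.exists_not_mem_of_walkConnected`),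
whose hypothesis on the contracted configuration `C` is WALK-CONNECTEDNESS in the incidence graph of the exceptional
curves («any two vertices of `C` are joined by a walk with support in `C`»).  Geometry supplies only that the closed
fibre of the resolution of the chart germ — the union of the curves `E_η = closure {η}`, `η ∈ C` — is CONNECTED
(Zariski, tree `IsResolution.isPreconnected_closedFibre`).  This file is the topological-combinatorial bridge, for an
arbitrary graph and an arbitrary finite family of closed sets:

* `exists_walk_of_isPreconnected_biUnion` — if `F i` (`i ∈ s`, `s` finite) are non-empty closed sets with
  preconnected union and `G.Adj i j` whenever `i ≠ j` and `F i ∩ F j ≠ ∅`, then any two indices of `s` are joined by a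
  `G`-walk with support in `s`;
* `walkConnected_of_isPreconnected_biUnion` — the same in the `∀ x ∈ C, ∀ y ∈ C, ∃ p, …` shape consumed by G-comb.

References: N. Bourbaki, *General Topology* I §11 (connected components of finite closed covers) [folklore]; tree
`…NoZenoTreeSeparation` (res-L0-w44-stub-2, p535354).
-/

-- single-problem summit: the doubled namespace component `ResolutionOfSingularities` is forced
set_option linter.dupNamespace false

namespace Summit.ResolutionOfSingularities.ResolutionOfSingularities.Theorems.NoZeno.ExcCount

open SimpleGraph

variable {α ι : Type*} [TopologicalSpace α] {G : SimpleGraph ι}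

/-- **A preconnected finite union of non-empty closed sets is walk-connected in the «meeting» graph.**  Let `s` be a
finite set of indices, `F i` (`i ∈ s`) non-empty closed subsets of a topological space with preconnected union, and
`G` a graph on the indices in which `i ≠ j` are adjacent whenever `F i` meets `F j`.  Then any two indices of `s` are
joined by a walk of `G` all of whose vertices lie in `s`.  (Split `s` into the indices reachable from `i` inside `s`
and the rest: the two partial unions are disjoint closed sets covering the union, so the second is empty.)
[folklore] -/
theorem exists_walk_of_isPreconnected_biUnion {s : Set ι} (hs : s.Finite) (F : ι → Set α)
    (hne : ∀ i ∈ s, (F i).Nonempty) (hcl : ∀ i ∈ s, IsClosed (F i))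
    (hadj : ∀ i ∈ s, ∀ j ∈ s, i ≠ j → (F i ∩ F j).Nonempty → G.Adj i j)
    (hconn : IsPreconnected (⋃ i ∈ s, F i)) {i j : ι} (hi : i ∈ s) (hj : j ∈ s) :
    ∃ p : G.Walk i j, ∀ v ∈ p.support, v ∈ s := by
  classical
  -- the indices reachable from `i` by walks inside `s`
  set K : Set ι := {j | j ∈ s ∧ ∃ p : G.Walk i j, ∀ v ∈ p.support, v ∈ s} with hK
  have hKs : K ⊆ s := fun j hj => hj.1
  have hiK : i ∈ K := ⟨hi, Walk.nil, by simp [hi]⟩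
  -- `K` is closed under adjacency inside `s`
  have hstep : ∀ j ∈ K, ∀ j' ∈ s, G.Adj j j' → j' ∈ K := by
    rintro j ⟨hjs, p, hp⟩ j' hj's hadj'
    refine ⟨hj's, p.append (Walk.cons hadj' Walk.nil), fun v hv => ?_⟩
    rw [Walk.support_append] at hv
    rcases List.mem_append.mp hv with hv | hv
    · exact hp v hv
    · simp only [Walk.support_cons, Walk.support_nil, List.tail_cons, List.mem_singleton] at hv
      exact hv ▸ hj's
  -- the two partial unions
  set A : Set α := ⋃ j ∈ K, F j with hA
  set B : Set α := ⋃ j ∈ s \ K, F j with hB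
  have hAcl : IsClosed A := (hs.subset hKs).isClosed_biUnion fun j hj => hcl j (hKs hj)
  have hBcl : IsClosed B := (hs.subset Set.sdiff_subset).isClosed_biUnion fun j hj => hcl j hj.1
  have hcover : (⋃ i ∈ s, F i) ⊆ A ∪ B := by
    intro x hx
    simp only [Set.mem_iUnion] at hx
    obtain ⟨j, hjs, hxj⟩ := hx
    by_cases hjK : j ∈ K
    · exact Or.inl (Set.mem_biUnion hjK hxj)
    · exact Or.inr (Set.mem_biUnion ⟨hjs, hjK⟩ hxj)
  have hdisj : A ∩ B = ∅ := by
    ext x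
    simp only [Set.mem_inter_iff, Set.mem_empty_iff_false, iff_false, not_and, hA, hB, Set.mem_iUnion]
    rintro ⟨j, hjK, hxj⟩ ⟨j', ⟨hj's, hj'K⟩, hxj'⟩
    have hne' : j ≠ j' := fun h => hj'K (h ▸ hjK)
    exact hj'K (hstep j hjK j' hj's (hadj j (hKs hjK) j' hj's hne' ⟨x, hxj, hxj'⟩))
  -- preconnectedness: the union meets `A` (at `F i`), so if it met `B` it would meet `A ∩ B = ∅`
  have hmeetA : ((⋃ i ∈ s, F i) ∩ A).Nonempty := by
    obtain ⟨x, hx⟩ := hne i hi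
    exact ⟨x, Set.mem_biUnion hi hx, Set.mem_biUnion hiK hx⟩
  have hB0 : ((⋃ i ∈ s, F i) ∩ B) = ∅ := by
    by_contra h
    have hmeetB : ((⋃ i ∈ s, F i) ∩ B).Nonempty := Set.nonempty_iff_ne_empty.mpr h
    obtain ⟨x, -, hxAB⟩ := (isPreconnected_closed_iff.mp hconn) A B hAcl hBcl hcover hmeetA hmeetB
    rw [hdisj] at hxAB
    exact hxAB
  -- hence `s \\ K` is empty: `j ∈ K`
  by_contra hjK'
  have hjK : j ∉ K := fun h => hjK' h.2
  obtain ⟨x, hx⟩ := hne j hj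
  have : x ∈ (⋃ i ∈ s, F i) ∩ B := ⟨Set.mem_biUnion hj hx, Set.mem_biUnion ⟨hj, hjK⟩ hx⟩
  rw [hB0] at this
  exact this

/-- **(A3) in G-comb's shape**: under the hypotheses of `exists_walk_of_isPreconnected_biUnion`, the index set `s`
is walk-connected — `∀ x ∈ s, ∀ y ∈ s, ∃ p : G.Walk x y, ∀ v ∈ p.support, v ∈ s` — the hypothesis `hC` of
`IsAcyclic.exists_not_mem_of_walkConnected` / `IsAcyclic.ncard_inter_le_of_walkConnected`. [folklore] -/
theorem walkConnected_of_isPreconnected_biUnion {s : Set ι} (hs : s.Finite) (F : ι → Set α)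
    (hne : ∀ i ∈ s, (F i).Nonempty) (hcl : ∀ i ∈ s, IsClosed (F i))
    (hadj : ∀ i ∈ s, ∀ j ∈ s, i ≠ j → (F i ∩ F j).Nonempty → G.Adj i j)
    (hconn : IsPreconnected (⋃ i ∈ s, F i)) :
    ∀ x ∈ s, ∀ y ∈ s, ∃ p : G.Walk x y, ∀ v ∈ p.support, v ∈ s :=
  fun _ hx _ hy => exists_walk_of_isPreconnected_biUnion hs F hne hcl hadj hconn hx hy

/-- **Closures of points**: the form used for exceptional curves `E_η = closure {η}` — if the points `η ∈ C` (`C`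
finite) have preconnected union of closures `⋃ closure {η}` and the graph joins `η ≠ η'` whenever their closures meet,
then `C` is walk-connected. [folklore] -/
theorem walkConnected_of_isPreconnected_biUnion_closure {X : Type*} [TopologicalSpace X] {G : SimpleGraph X}
    {C : Set X} (hC : C.Finite)
    (hadj : ∀ η ∈ C, ∀ η' ∈ C, η ≠ η' → (closure {η} ∩ closure {η'} : Set X).Nonempty → G.Adj η η')
    (hconn : IsPreconnected (⋃ η ∈ C, closure ({η} : Set X))) :
    ∀ x ∈ C, ∀ y ∈ C, ∃ p : G.Walk x y, ∀ v ∈ p.support, v ∈ C :=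
  walkConnected_of_isPreconnected_biUnion hC (fun η => closure ({η} : Set X))
    (fun η _ => ⟨η, subset_closure rfl⟩) (fun _ _ => isClosed_closure) hadj hconn

end Summit.ResolutionOfSingularities.ResolutionOfSingularities.Theorems.NoZeno.ExcCount
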